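import Summits.CriticalPhenomena.PercolationContinuityZ3.Theorems.SahiMasterFamilyHFlat

/-!
# H♭(4) holds: `Σ_t β_{t}·Φ_4(cap_t β) ≤ 4·Φ_4(β)` on the union-closed hull (indeed on the linear relaxation: box + top + pairwise union)

Unit `prim-masterthm-p4` (gen 18; crux anchor stmt-CriticalPhenomena-4575, helper work; memo
`run/shared/lean/prim/prim-masterthm/prim-masterthm-p4/P4-GEN18-REPORT.md` §8 (R16c)).  Companion of `…HFlat` (typed H♭, `H♯ ⟹ H♭ ⟹ (UC-hull)`, H♭(3) on
the bare box).  **THEOREM `hFlatNonneg_four : HFlatNonneg 4`.**  Unlike H♯ (false on the linear relaxation from k = 5 and needing a sign split already at k = 3),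
H♭(4) holds on the LINEAR relaxation `0 ≤ β ≤ 1`, `β_univ = 1`, `β_S + β_T ≤ 1 + β_{S∪T}`: an explicit 31-term certificate (products of ≤ 3 atoms
`β_S`, `1 − β_S`, `1 + β_{S∪T} − β_S − β_T`, nonnegative rational coefficients; found by LP and verified exactly, kit job j174359) gives
`4Φ_4(β) − Σ_t β_{t}Φ_4(cap_t β) = Σ_j c_j·(product_j)` identically (`hFlat_four_of_pairUnion`).  Every mixture of union-closed indicator functions satisfies the
hypotheses pointwise, whence `hFlatNonneg_four` and, down the ladder, yet another `(UC-hull)_4`.  HONEST FRAMING: H♭(k) k ≥ 5, H♯(k) k ≥ 4, (UC-hull)_k k ≥ 8,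
Sahi's `C_k` and the master theorem remain OPEN.  Axioms standard. [this work]
-/

noncomputable section

open scoped Classical

namespace Summit.CriticalPhenomena.PercolationContinuityZ3.Theorems

namespace HFlat

open Finset
open Literature.Combinatorics.Sahi2008
open PrincipalCapBeta (phiSet)
open GHConjecture (UCHullNonneg)
open HSharp (mixture_le_one)

set_option maxHeartbeats 4000000 in
/-- **H♭(4) on the box under the pairwise-union inequalities** (explicit LP certificate, 31 terms). [this work] -/
theorem hFlat_four_of_pairUnion (β : Finset (Fin 4) → ℝ) (h0 : ∀ B, 0 ≤ β B) (h1 : ∀ B, β B ≤ 1) (huniv : β univ = 1)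
    (hu : ∀ S T : Finset (Fin 4), β S + β T ≤ 1 + β (S ∪ T)) :
    ∑ t : Fin 4, β {t} * phiSet 4 (fun S => if t ∈ S then 1 else β S) ≤ (4 : ℝ) * phiSet 4 β := by
  have c1 : ∀ B, 0 ≤ 1 - β B := fun B => sub_nonneg.2 (h1 B)
  have u_1_2 : 0 ≤ 1 + β {0, 1} - β {0} - β {1} := by
    have := hu {0} {1}; rw [show ({0} : Finset (Fin 4)) ∪ {1} = {0, 1} by decide] at this; linarith
  have u_1_4 : 0 ≤ 1 + β {0, 2} - β {0} - β {2} := by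
    have := hu {0} {2}; rw [show ({0} : Finset (Fin 4)) ∪ {2} = {0, 2} by decide] at this; linarith
  have u_1_8 : 0 ≤ 1 + β {0, 3} - β {0} - β {3} := by
    have := hu {0} {3}; rw [show ({0} : Finset (Fin 4)) ∪ {3} = {0, 3} by decide] at this; linarith
  have u_2_4 : 0 ≤ 1 + β {1, 2} - β {1} - β {2} := by
    have := hu {1} {2}; rw [show ({1} : Finset (Fin 4)) ∪ {2} = {1, 2} by decide] at this; linarith
  have u_2_8 : 0 ≤ 1 + β {1, 3} - β {1} - β {3} := by
    have := hu {1} {3}; rw [show ({1} : Finset (Fin 4)) ∪ {3} = {1, 3} by decide] at this; linarith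
  have u_3_9 : 0 ≤ 1 + β {0, 1, 3} - β {0, 1} - β {0, 3} := by
    have := hu {0, 1} {0, 3}; rw [show ({0, 1} : Finset (Fin 4)) ∪ {0, 3} = {0, 1, 3} by decide] at this; linarith
  have u_4_8 : 0 ≤ 1 + β {2, 3} - β {2} - β {3} := by
    have := hu {2} {3}; rw [show ({2} : Finset (Fin 4)) ∪ {3} = {2, 3} by decide] at this; linarith
  have u_5_9 : 0 ≤ 1 + β {0, 2, 3} - β {0, 2} - β {0, 3} := by
    have := hu {0, 2} {0, 3}; rw [show ({0, 2} : Finset (Fin 4)) ∪ {0, 3} = {0, 2, 3} by decide] at this; linarith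
  have u_9_12 : 0 ≤ 1 + β {0, 2, 3} - β {0, 3} - β {2, 3} := by
    have := hu {0, 3} {2, 3}; rw [show ({0, 3} : Finset (Fin 4)) ∪ {2, 3} = {0, 2, 3} by decide] at this; linarith
  have u_10_12 : 0 ≤ 1 + β {1, 2, 3} - β {1, 3} - β {2, 3} := by
    have := hu {1, 3} {2, 3}; rw [show ({1, 3} : Finset (Fin 4)) ∪ {2, 3} = {1, 2, 3} by decide] at this; linarith
  have u_11_13 : 0 ≤ 2 - β {0, 1, 3} - β {0, 2, 3} := by
    have := hu {0, 1, 3} {0, 2, 3}; rw [show ({0, 1, 3} : Finset (Fin 4)) ∪ {0, 2, 3} = univ by decide, huniv] at this; linarith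
  have u_13_14 : 0 ≤ 2 - β {0, 2, 3} - β {1, 2, 3} := by
    have := hu {0, 2, 3} {1, 2, 3}; rw [show ({0, 2, 3} : Finset (Fin 4)) ∪ {1, 2, 3} = univ by decide, huniv] at this; linarith
  have t0 : 0 ≤ β {0} * (1 - β {1, 2, 3}) := (mul_nonneg (h0 {0}) (c1 {1, 2, 3}))
  have t1 : 0 ≤ β {1} * (1 - β {0, 2, 3}) := (mul_nonneg (h0 {1}) (c1 {0, 2, 3}))
  have t2 : 0 ≤ β {2} * (1 - β {0, 1, 3}) := (mul_nonneg (h0 {2}) (c1 {0, 1, 3}))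
  have t3 : 0 ≤ β {3} * (1 - β {0, 1, 2}) := (mul_nonneg (h0 {3}) (c1 {0, 1, 2}))
  have t4 : 0 ≤ β {0} * (1 - β {1}) * (1 - β {2, 3}) := (mul_nonneg (mul_nonneg (h0 {0}) (c1 {1})) (c1 {2, 3}))
  have t5 : 0 ≤ β {0} * (1 - β {2}) * (1 - β {1, 3}) := (mul_nonneg (mul_nonneg (h0 {0}) (c1 {2})) (c1 {1, 3}))
  have t6 : 0 ≤ β {0} * (1 - β {1, 2}) * (1 - β {3}) := (mul_nonneg (mul_nonneg (h0 {0}) (c1 {1, 2})) (c1 {3}))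
  have t7 : 0 ≤ β {1} * (1 - β {0}) * (1 - β {2, 3}) := (mul_nonneg (mul_nonneg (h0 {1}) (c1 {0})) (c1 {2, 3}))
  have t8 : 0 ≤ β {1} * (1 - β {2}) * (1 - β {0, 3}) := (mul_nonneg (mul_nonneg (h0 {1}) (c1 {2})) (c1 {0, 3}))
  have t9 : 0 ≤ β {1} * (1 - β {0, 2}) * (1 - β {3}) := (mul_nonneg (mul_nonneg (h0 {1}) (c1 {0, 2})) (c1 {3}))
  have t10 : 0 ≤ β {2} * (1 - β {0, 1}) * (1 - β {3}) := (mul_nonneg (mul_nonneg (h0 {2}) (c1 {0, 1})) (c1 {3}))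
  have t11 : 0 ≤ β {3} * (1 - β {0}) * (1 - β {1, 2}) := (mul_nonneg (mul_nonneg (h0 {3}) (c1 {0})) (c1 {1, 2}))
  have t12 : 0 ≤ β {3} * (1 - β {0, 1}) * (1 - β {2}) := (mul_nonneg (mul_nonneg (h0 {3}) (c1 {0, 1})) (c1 {2}))
  have t13 : 0 ≤ (1 + β {0, 1} - β {0} - β {1}) * (1 - β {2, 3}) := (mul_nonneg u_1_2 (c1 {2, 3}))
  have t14 : 0 ≤ (1 + β {0, 1} - β {0} - β {1}) * (1 - β {2}) * (1 - β {3}) := (mul_nonneg (mul_nonneg u_1_2 (c1 {2})) (c1 {3}))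
  have t15 : 0 ≤ (1 + β {0, 2} - β {0} - β {2}) * (1 - β {1, 3}) := (mul_nonneg u_1_4 (c1 {1, 3}))
  have t16 : 0 ≤ (1 + β {0, 2} - β {0} - β {2}) * (1 - β {1}) * (1 - β {3}) := (mul_nonneg (mul_nonneg u_1_4 (c1 {1})) (c1 {3}))
  have t17 : 0 ≤ (1 + β {0, 3} - β {0} - β {3}) * (1 - β {1, 2}) := (mul_nonneg u_1_8 (c1 {1, 2}))
  have t18 : 0 ≤ (1 + β {0, 3} - β {0} - β {3}) * (1 - β {1}) * (1 - β {2}) := (mul_nonneg (mul_nonneg u_1_8 (c1 {1})) (c1 {2}))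
  have t19 : 0 ≤ (1 + β {1, 2} - β {1} - β {2}) * (1 - β {0, 3}) := (mul_nonneg u_2_4 (c1 {0, 3}))
  have t20 : 0 ≤ (1 + β {1, 2} - β {1} - β {2}) * (1 - β {0}) * (1 - β {3}) := (mul_nonneg (mul_nonneg u_2_4 (c1 {0})) (c1 {3}))
  have t21 : 0 ≤ (1 + β {1, 3} - β {1} - β {3}) * (1 - β {0, 2}) := (mul_nonneg u_2_8 (c1 {0, 2}))
  have t22 : 0 ≤ (1 + β {1, 3} - β {1} - β {3}) * (1 - β {0}) * (1 - β {2}) := (mul_nonneg (mul_nonneg u_2_8 (c1 {0})) (c1 {2}))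
  have t23 : 0 ≤ (1 + β {0, 1, 3} - β {0, 1} - β {0, 3}) * (1 - β {2}) := (mul_nonneg u_3_9 (c1 {2}))
  have t24 : 0 ≤ (1 + β {2, 3} - β {2} - β {3}) * (1 - β {0, 1}) := (mul_nonneg u_4_8 (c1 {0, 1}))
  have t25 : 0 ≤ (1 + β {2, 3} - β {2} - β {3}) * (1 - β {0}) * (1 - β {1}) := (mul_nonneg (mul_nonneg u_4_8 (c1 {0})) (c1 {1}))
  have t26 : 0 ≤ (1 + β {0, 2, 3} - β {0, 2} - β {0, 3}) * (1 - β {1}) := (mul_nonneg u_5_9 (c1 {1}))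
  have t27 : 0 ≤ (1 + β {0, 2, 3} - β {0, 3} - β {2, 3}) * (1 - β {1}) := (mul_nonneg u_9_12 (c1 {1}))
  have t28 : 0 ≤ (1 + β {1, 2, 3} - β {1, 3} - β {2, 3}) * (1 - β {0}) := (mul_nonneg u_10_12 (c1 {0}))
  have t29 : 0 ≤ (2 - β {0, 1, 3} - β {0, 2, 3}) := u_11_13
  have t30 : 0 ≤ (2 - β {0, 2, 3} - β {1, 2, 3}) := u_13_14
  simp only [PrincipalCapBeta.phiSet_four, Fin.sum_univ_four, Fin.isValue, mem_univ, if_true, mem_insert, mem_singleton, huniv]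
  norm_num [Fin.ext_iff]
  linarith [mul_nonneg (by norm_num : (0:ℝ) ≤ 5/1) t0, mul_nonneg (by norm_num : (0:ℝ) ≤ 9/2) t1, mul_nonneg (by norm_num : (0:ℝ) ≤ 11/2) t2, mul_nonneg (by norm_num : (0:ℝ) ≤ 6/1) t3, mul_nonneg (by norm_num : (0:ℝ) ≤ 3/4) t4, mul_nonneg (by norm_num : (0:ℝ) ≤ 1/1) t5, mul_nonneg (by norm_num : (0:ℝ) ≤ 1/2) t6, mul_nonneg (by norm_num : (0:ℝ) ≤ 1/4) t7, mul_nonneg (by norm_num : (0:ℝ) ≤ 1/1) t8, mul_nonneg (by norm_num : (0:ℝ) ≤ 1/1) t9, mul_nonneg (by norm_num : (0:ℝ) ≤ 3/4) t10, mul_nonneg (by norm_num : (0:ℝ) ≤ 1/2) t11, mul_nonneg (by norm_num : (0:ℝ) ≤ 1/4) t12, mul_nonneg (by norm_num : (0:ℝ) ≤ 7/4) t13, mul_nonneg (by norm_num : (0:ℝ) ≤ 1/1) t14, mul_nonneg (by norm_num : (0:ℝ) ≤ 2/1) t15, mul_nonneg (by norm_num : (0:ℝ) ≤ 1/1) t16,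 mul_nonneg (by norm_num : (0:ℝ) ≤ 5/2) t17, mul_nonneg (by norm_num : (0:ℝ) ≤ 1/1) t18, mul_nonneg (by norm_num : (0:ℝ) ≤ 3/2) t19, mul_nonneg (by norm_num : (0:ℝ) ≤ 1/1) t20, mul_nonneg (by norm_num : (0:ℝ) ≤ 2/1) t21, mul_nonneg (by norm_num : (0:ℝ) ≤ 1/1) t22, mul_nonneg (by norm_num : (0:ℝ) ≤ 1/2) t23, mul_nonneg (by norm_num : (0:ℝ) ≤ 9/4) t24, mul_nonneg (by norm_num : (0:ℝ) ≤ 1/1) t25, mul_nonneg (by norm_num : (0:ℝ) ≤ 1/1) t26, mul_nonneg (by norm_num : (0:ℝ) ≤ 1/2) t27, mul_nonneg (by norm_num : (0:ℝ) ≤ 1/1) t28, mul_nonneg (by norm_num : (0:ℝ) ≤ 1/2) t29, mul_nonneg (by norm_num : (0:ℝ) ≤ 1/1) t30]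

/-- **H♭(4)** (`HFlatNonneg 4`): every mixture of union-closed indicator functions containing `univ` lies in the box with top value one and
satisfies every pairwise-union inequality. [this work] -/
theorem hFlatNonneg_four : HFlatNonneg 4 := by
  intro α _ w 𝒰 hw0 hw1 hUC htop
  set β : Finset (Fin 4) → ℝ := fun S => ∑ x, w x * (if S ∈ 𝒰 x then (1 : ℝ) else 0) with hβ
  have h0 : ∀ B, 0 ≤ β B := fun B => mixture_nonneg w 𝒰 hw0 B
  have h1 : ∀ B, β B ≤ 1 := fun B => mixture_le_one w 𝒰 hw0 hw1 B
  have huniv : β univ = 1 := by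
    have : ∀ x, w x * (if (univ : Finset (Fin 4)) ∈ 𝒰 x then (1 : ℝ) else 0) = w x := fun x => by
      rw [if_pos (htop x), mul_one]
    simp only [hβ, this, hw1]
  have hu : ∀ S T : Finset (Fin 4), β S + β T ≤ 1 + β (S ∪ T) := by
    intro S T
    have hpt : ∀ x, w x * (if S ∈ 𝒰 x then (1 : ℝ) else 0) + w x * (if T ∈ 𝒰 x then (1 : ℝ) else 0) ≤
        w x * 1 + w x * (if S ∪ T ∈ 𝒰 x then (1 : ℝ) else 0) := by
      intro x
      rw [← mul_add, ← mul_add]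
      refine mul_le_mul_of_nonneg_left ?_ (hw0 x)
      by_cases hS : S ∈ 𝒰 x
      · by_cases hT : T ∈ 𝒰 x
        · rw [if_pos hS, if_pos hT, if_pos (hUC x S hS T hT)]
        · rw [if_pos hS, if_neg hT]; split_ifs <;> norm_num
      · rw [if_neg hS]; split_ifs <;> norm_num
    calc β S + β T = ∑ x, (w x * (if S ∈ 𝒰 x then (1 : ℝ) else 0) + w x * (if T ∈ 𝒰 x then (1 : ℝ) else 0)) := by
          rw [hβ, ← sum_add_distrib]
      _ ≤ ∑ x, (w x * 1 + w x * (if S ∪ T ∈ 𝒰 x then (1 : ℝ) else 0)) := sum_le_sum fun x _ => hpt x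
      _ = 1 + β (S ∪ T) := by rw [sum_add_distrib, ← sum_mul, hw1, one_mul]
  show ∑ t : Fin 4, β {t} * phiSet 4 (fun S => if t ∈ S then 1 else β S) ≤ ((4 : ℕ) : ℝ) * phiSet 4 β
  exact_mod_cast hFlat_four_of_pairUnion β h0 h1 huniv hu

/-- Down the ladder once more: `(UC-hull)_4` from H♭(4). [this work] -/
theorem ucHullNonneg_four' : UCHullNonneg 4 := ucHullNonneg_of_hFlatNonneg hFlatNonneg_four

end HFlat

end Summit.CriticalPhenomena.PercolationContinuityZ3.Theorems
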